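import Mathlib
import HarnessLib
import Summits.NavierStokesRegularity.FluidComputer.TriggeredTransferH1Cascade

/-!
# What the cascade actually asks of the physics: transfers WITH THE LEVEL SEEDS only —
# `(log Re)²` e-folds per level, not `Re` (door N1-FC v2, the minimal `∀`-form that closes (C))

Cell `ns-blowup`, seat `ns-blowup-fc-prover-1` (g5; D-0074 GROUP C «bridge support», door N1-FC).
Companion of `TriggeredTransferH1.lean` (door v2 type `TriggerSchemeH1`, seat `ns-blowup-fc-prover-2`
g5) and `TriggeredTransferH1Cascade.lean` (this seat: `Transfers ν → Nonempty (core.Cascade ν) →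
NavierStokesBreakdownR3`, no named fact). LABEL: E–C typing + analysis. WHAT THIS IS NOT: not
Navier–Stokes evidence and not a construction — one more OPEN predicate, WEAKER than
`TriggerSchemeH1.Transfers`, and implications from it; asserted nowhere; no scheme instance, cascade,
transfer or blow-up is claimed; MODEL words (PREREG-FC-TRIG-1 and -2) never enter.

## The observation

`TriggerSchemeH1.Transfers ν` demands one triggered transfer from every working state at every
amplitude `U ≥ U⋆` for EVERY admissible trigger amplitude `ε ∈ (0, 1]`, `ν |log ε| ≤ a U` — i.e. the
capacity to amplify a seed by up to `exp (a U / ν)` (LINEARLY many e-folds in the level Reynolds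
number `U/ν`). The cascade gluing never uses that much: level `n` of a cascade is fired with the LEVEL
SEED `seedAt ν n U = max (exp (-(a U / ν))) (λ^{-n²})` (`TriggeredTransferRun.lean`), whose e-fold
count is `|log ε| ≤ n² log λ`, and along a cascade `U_n ≥ U⋆ · growthⁿ` (`growth = (ηλ)^{1/2} > 1`), so

  `|log ε_n| ≤ (log λ / (log growth)²) · (log (U_n / U⋆))²` (`abs_log_seedAt_le_polylog`)

— POLY-LOGARITHMICALLY many e-folds in the Reynolds number, delivered within
`T_n ≤ C_τ (1 + n² log λ)^q / U_n` turnover-scaled time, which at high levels is a vanishing fraction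
of the viscous time of the unit-scale structure. (At level `0` the seed is `ε = 1`: the first
transfers may be force-driven; self-amplification is needed only asymptotically, by `λ^{n²}`.)

## Contents

* `TriggerSchemeH1.TransfersSeeded ν` — **the scheme transfers with the level seeds**: for every
  level `n`, from every working state at every amplitude `U ≥ U⋆ · growthⁿ`, ONE triggered transfer
  with trigger amplitude `seedAt ν n U` into the working alphabet. Open; never asserted.
* `Transfers.seeded : 0 < ν → Transfers ν → TransfersSeeded ν` (the level seeds are admissible) —
  the seeded door is formally WEAKER than door v2;
* `abs_log_seedAt_le_polylog` — the e-fold count above;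
* **`nonempty_cascade_of_seeded : TransfersSeeded ν → Nonempty (core.Cascade ν)`**
  (dependent choice with LEVEL-INDEXED states `U ≥ U⋆ growthⁿ`), hence
  **`navierStokesBreakdownR3_of_transfersSeeded : 0 < ν → TransfersSeeded ν → NavierStokesBreakdownR3`**
  and the `∃`-form — ZERO named facts;
* for the record, the v1 existential closer WITHOUT W14:
  `TriggerScheme.navierStokesBreakdownR3_of_exists_transfers' : (∃ 𝒮 : TriggerScheme, 𝒮.Transfers 1)
  → NavierStokesBreakdownR3`.

References: T. Tao, J. Amer. Math. Soc. 29 (2016) 601–674, §1.3 (machine paradigm; the clock and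
the trigger) [cite: Tao2016AveragedNS, §1.3]; C. L. Fefferman, Clay problem description, (C)
[cite: FeffermanClay2006, (C)]. 0 sorry; axioms ⊆ {propext, Classical.choice, Quot.sound}.
-/

noncomputable section

namespace Summit.NavierStokesRegularity.FluidComputer.TriggeredTransfer

open Set Filter Function MeasureTheory
open scoped Topology ENNReal ContDiff
open Literature.Analysis.FluidPDE
open Literature.Analysis.FluidPDE.FluidComputer (E3 Vel)
open Summit.NavierStokesRegularity.FluidComputer.PalasekTowerClayBridge (BreakdownWitness)

namespace TriggerSchemeH1

variable (𝒮 : TriggerSchemeH1)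

/-- **The scheme transfers WITH THE LEVEL SEEDS at viscosity `ν`**: for every level `n`, from every
working state `w ∈ F U` at every amplitude `U ≥ U⋆ · growthⁿ` (the amplitudes level `n` of a cascade
can have), ONE triggered transfer into the working alphabet fired with the level seed
`ε = max (exp (-(a U / ν))) (λ^{-n²})` (`= core.seedAt ν n U`: e-folds `|log ε| ≤ n² log λ`, clock
`T ≤ C_τ (1 + |log ε|)^q / U`). Exactly what the cascade gluing consumes; implied by `Transfers ν`
(`Transfers.seeded`). The physics of door N1-FC in its minimal `∀`-form; open, never asserted.
[cite: Tao2016AveragedNS, §1.3] -/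
def TransfersSeeded (ν : ℝ) : Prop :=
  ∀ (n : ℕ) (U : ℝ), 𝒮.UStar * 𝒮.growth ^ n ≤ U → ∀ w ∈ 𝒮.F U,
    𝒮.Step ν U (max (Real.exp (-(𝒮.a * U / ν))) ((𝒮.lam ^ (n ^ 2))⁻¹)) w

/-- The level seed written out is the core's `seedAt`. [folklore] -/
theorem core_seedAt (ν : ℝ) (n : ℕ) (U : ℝ) :
    𝒮.core.seedAt ν n U = max (Real.exp (-(𝒮.a * U / ν))) ((𝒮.lam ^ (n ^ 2))⁻¹) := rfl

/-- An amplitude `U ≥ U⋆ · growthⁿ` is above threshold. [folklore] -/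
theorem UStar_le_of_level {n : ℕ} {U : ℝ} (hU : 𝒮.UStar * 𝒮.growth ^ n ≤ U) : 𝒮.UStar ≤ U :=
  (le_mul_of_one_le_right 𝒮.UStar_pos.le (one_le_pow₀ 𝒮.one_lt_growth.le)).trans hU

variable {𝒮} in
/-- **Door v2 implies the seeded door** (`ν > 0`): the level seeds are admissible trigger amplitudes
(`seedAt_pos`, `seedAt_le_one`, `seedAt_admissible` of the core). [folklore] -/
theorem Transfers.seeded {ν : ℝ} (hν : 0 < ν) (hT : 𝒮.Transfers ν) : 𝒮.TransfersSeeded ν := by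
  intro n U hU w hw
  have hUS : 𝒮.UStar ≤ U := 𝒮.UStar_le_of_level hU
  have hU0 : 0 ≤ U := 𝒮.UStar_pos.le.trans hUS
  rw [← core_seedAt]
  exact hT U hUS w hw _ (𝒮.core.seedAt_pos ν n U) (𝒮.core.seedAt_le_one hν n hU0)
    (𝒮.core.seedAt_admissible hν n hU0)

/-- **Poly-logarithmically many e-folds**: at an amplitude `U ≥ U⋆ · growthⁿ` the level-`n` seed
has `|log ε| ≤ (log λ / (log growth)²) · (log (U / U⋆))²` (`ν > 0`) — from `|log ε| ≤ n² log λ` and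
`n log growth ≤ log (U/U⋆)`. Compare the admissibility budget `ν |log ε| ≤ a U` of `Transfers`:
linear in `U`. [folklore] -/
theorem abs_log_seedAt_le_polylog {ν : ℝ} (hν : 0 < ν) {n : ℕ} {U : ℝ}
    (hU : 𝒮.UStar * 𝒮.growth ^ n ≤ U) :
    |Real.log (𝒮.core.seedAt ν n U)| ≤
      Real.log 𝒮.lam / Real.log 𝒮.growth ^ 2 * Real.log (U / 𝒮.UStar) ^ 2 := by
  have hg1 : 1 < 𝒮.growth := 𝒮.one_lt_growth
  have hlg : 0 < Real.log 𝒮.growth := Real.log_pos hg1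
  have hS : 0 < 𝒮.UStar := 𝒮.UStar_pos
  have hgn : 0 < 𝒮.growth ^ n := pow_pos (zero_lt_one.trans hg1) n
  have hU0 : 0 < U := lt_of_lt_of_le (mul_pos hS hgn) hU
  have h1 : |Real.log (𝒮.core.seedAt ν n U)| ≤ (n : ℝ) ^ 2 * Real.log 𝒮.lam :=
    𝒮.core.abs_log_seedAt_le hν n hU0.le
  have h2 : (n : ℝ) * Real.log 𝒮.growth ≤ Real.log (U / 𝒮.UStar) := by
    rw [← Real.log_pow]
    refine Real.log_le_log hgn ?_
    rw [le_div_iff₀ hS, mul_comm]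
    exact hU
  have h3 : ((n : ℝ) * Real.log 𝒮.growth) ^ 2 ≤ Real.log (U / 𝒮.UStar) ^ 2 :=
    pow_le_pow_left₀ (by positivity) h2 2
  have hlam : 0 ≤ Real.log 𝒮.lam := Real.log_nonneg 𝒮.one_lt_lam.le
  calc |Real.log (𝒮.core.seedAt ν n U)| ≤ (n : ℝ) ^ 2 * Real.log 𝒮.lam := h1
    _ = Real.log 𝒮.lam / Real.log 𝒮.growth ^ 2 * ((n : ℝ) * Real.log 𝒮.growth) ^ 2 := by
        field_simp
    _ ≤ Real.log 𝒮.lam / Real.log 𝒮.growth ^ 2 * Real.log (U / 𝒮.UStar) ^ 2 :=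
        mul_le_mul_of_nonneg_left h3 (div_nonneg hlam (sq_nonneg _))

/-- **The clock at the level seed**: `T ≤ C_τ (1 + n² log λ)^q / U` — poly-logarithmically many
turnovers in the level (hence in `log Re`). [folklore] -/
theorem clock_le_of_level {ν : ℝ} (hν : 0 < ν) {n : ℕ} {U : ℝ}
    (hU : 𝒮.UStar * 𝒮.growth ^ n ≤ U) {w : Vel}
    (L : 𝒮.Link ν U (𝒮.core.seedAt ν n U) w) :
    L.T ≤ 𝒮.Cτ * (1 + (n : ℝ) ^ 2 * Real.log 𝒮.lam) ^ 𝒮.q / U := by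
  have hU0 : 0 < U :=
    lt_of_lt_of_le (mul_pos 𝒮.UStar_pos (pow_pos 𝒮.core.growth_pos n)) hU
  exact L.T_le.trans (𝒮.core.clock_le_of_seedAt hν n hU0)

/-! ## From the seeded door to a cascade: dependent choice with level-indexed states -/

/-- **A scheme that transfers with the level seeds has a cascade** (any `ν`): as
`TriggerSchemeH1.nonempty_cascade`, but the state reached at level `n` is recorded together with the
bound `U ≥ U⋆ · growthⁿ` it inherits from the climb (`U' ≥ growth · U`), which is all the seeded door
needs to fire the next transfer. [cite: Tao2016AveragedNS, §1.3] -/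
theorem nonempty_cascade_of_seeded {ν : ℝ} (hT : 𝒮.TransfersSeeded ν) :
    Nonempty (𝒮.core.Cascade ν) := by
  classical
  -- level-indexed admissible working states
  let X : ℕ → Type := fun n => {q : ℝ × Vel // 𝒮.UStar * 𝒮.growth ^ n ≤ q.1 ∧ q.2 ∈ 𝒮.F q.1}
  have key : ∀ (n : ℕ) (q : X n), Nonempty (𝒮.Link ν q.1.1 (𝒮.core.seedAt ν n q.1.1) q.1.2) :=
    fun n q => 𝒮.step_iff_nonempty_link.1 (hT n q.1.1 q.2.1 q.1.2 q.2.2)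
  let lk : ∀ (n : ℕ) (q : X n), 𝒮.Link ν q.1.1 (𝒮.core.seedAt ν n q.1.1) q.1.2 := fun n q =>
    Classical.choice (key n q)
  -- the climb: the hand-over amplitude is a level-(n+1) amplitude
  have hclimb : ∀ (n : ℕ) (q : X n), 𝒮.UStar * 𝒮.growth ^ (n + 1) ≤ (lk n q).U' := by
    intro n q
    calc 𝒮.UStar * 𝒮.growth ^ (n + 1) = 𝒮.growth * (𝒮.UStar * 𝒮.growth ^ n) := by ring
      _ ≤ 𝒮.growth * q.1.1 := mul_le_mul_of_nonneg_left q.2.1 (𝒮.core.growth_pos).le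
      _ ≤ (lk n q).U' := (lk n q).growth_le
  let nx : ∀ n, X n → X (n + 1) := fun n q => ⟨((lk n q).U', (lk n q).w'), hclimb n q, (lk n q).mem⟩
  obtain ⟨U₀, hU₀, w₀, hw₀, hd₀⟩ := 𝒮.seed
  have hU₀' : 𝒮.UStar * 𝒮.growth ^ 0 ≤ U₀ := by rw [pow_zero, mul_one]; exact hU₀
  let q₀ : X 0 := ⟨(U₀, w₀), hU₀', hw₀⟩
  let st : ∀ n, X n := fun n => Nat.rec (motive := fun n => X n) q₀ (fun k q => nx k q) n
  have hst : ∀ n, st (n + 1) = nx n (st n) := fun n => rfl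
  have hst0 : st 0 = q₀ := rfl
  have hreg : ∀ n, ContDiff ℝ ∞ (st n).1.2 ∧ NSWave0.IsDivFree (st n).1.2 ∧
      MemLp (st n).1.2 2 volume ∧ MemLp (fderiv ℝ (st n).1.2) 2 volume :=
    fun n => 𝒮.regular _ (𝒮.UStar_le_of_level (st n).2.1) _ (st n).2.2
  exact ⟨{ U := fun n => (st n).1.1
           w := fun n => (st n).1.2
           link := fun n => (lk n (st n)).toPiece
           UStar_le_zero := hU₀
           U_succ := fun n => by rw [hst n]; rfl
           w_succ := fun n => by rw [hst n]; rfl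
           decay_zero := by rw [hst0]; exact hd₀
           smooth := fun n => (hreg n).1
           divFree := fun n => (hreg n).2.1
           h1 := fun n => (hreg n).2.2
           floor := fun n => 𝒮.floor _ (𝒮.UStar_le_of_level (st n).2.1) _ (st n).2.2 }⟩

/-! ## The seeded door closes on (C), with no named fact -/

/-- **The seeded door yields an exact forced blow-up** (`ν > 0`). UNCONDITIONAL. [cite: Tao2016AveragedNS, §1.3] -/
theorem nonempty_breakdownWitness_of_seeded {ν : ℝ} (hν : 0 < ν) (hT : 𝒮.TransfersSeeded ν) :
    Nonempty (BreakdownWitness ν) :=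
  𝒮.core.nonempty_breakdownWitness_of_cascade hν (𝒮.nonempty_cascade_of_seeded hT)

/-- **The seeded door closes on Fefferman's (C) modulo its physics ALONE**: a scheme transferring
with the level seeds at one viscosity `ν > 0` gives `NavierStokesBreakdownR3` — ZERO named facts.
[cite: FeffermanClay2006, (C)] -/
theorem navierStokesBreakdownR3_of_transfersSeeded {ν : ℝ} (hν : 0 < ν)
    (hT : 𝒮.TransfersSeeded ν) :
    Summit.NavierStokesRegularity.NavierStokesRegularity.NavierStokesBreakdownR3 :=
  𝒮.core.navierStokesBreakdownR3_of_cascade hν (𝒮.nonempty_cascade_of_seeded hT)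

/-- The existential form: SOME `H¹` scheme transfers with the level seeds at unit viscosity ⇒ (C).
[cite: FeffermanClay2006, (C)] -/
theorem navierStokesBreakdownR3_of_exists_transfersSeeded
    (h : ∃ 𝒮 : TriggerSchemeH1, 𝒮.TransfersSeeded 1) :
    Summit.NavierStokesRegularity.NavierStokesRegularity.NavierStokesBreakdownR3 := by
  obtain ⟨𝒮, hT⟩ := h
  exact 𝒮.navierStokesBreakdownR3_of_transfersSeeded one_pos hT

/-- The existential seeded door is implied by the existential door v2 (at `ν > 0`). [folklore] -/
theorem exists_transfersSeeded_of_exists_transfers {ν : ℝ} (hν : 0 < ν)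
    (h : ∃ 𝒮 : TriggerSchemeH1, 𝒮.Transfers ν) : ∃ 𝒮 : TriggerSchemeH1, 𝒮.TransfersSeeded ν := by
  obtain ⟨𝒮, hT⟩ := h
  exact ⟨𝒮, hT.seeded hν⟩

end TriggerSchemeH1

/-! ## For the record: the v1 existential door closes (C) without W14 -/

/-- **Door v1 (Clay alphabet), existential form, closes on (C) with NO named fact**: the g2 closer
`navierStokesBreakdownR3_of_exists_transfers` without its W14 hypothesis, through the embedding
`toH1` and the cascade. [cite: FeffermanClay2006, (C)] -/
theorem TriggerScheme.navierStokesBreakdownR3_of_exists_transfers'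
    (h : ∃ 𝒮 : TriggerScheme, 𝒮.Transfers 1) :
    Summit.NavierStokesRegularity.NavierStokesRegularity.NavierStokesBreakdownR3 :=
  TriggerSchemeH1.navierStokesBreakdownR3_of_exists_transfers (exists_transfersH1_of_exists_transfers h)

end Summit.NavierStokesRegularity.FluidComputer.TriggeredTransfer

end
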